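import Summits.Ventures.Crystal3D.Theorems.StickyWulffConstantTextureBuildHealFamily
import Summits.Ventures.Crystal3D.Theorems.StickyWulffConstantGenericWallFloorPayerMultiplicity
import HarnessLib

/-!
# TB-1 brick L-HEAL, collar form: the site surgery's bill is paid by the DEFECTS IN THE 3-COLLAR of the window (no geometry of the junk needed)
# (lane T, crux `TextureLiminfV5`, stmt-Ventures-23912; memo HOME/wulff-p2/g25/SLAB-PLATES-g25.md §3 «plates by slab surgery + pigeonhole»)

HONEST FRAMING. Venture `Summits/Ventures/Crystal3D` (cell `crystal3d-full`), route `route-Ventures-StickyWulffConstant`, helper `--supports` the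
law-v5 crux `TextureLiminfV5` (stmt-Ventures-23912).  Pure finite combinatorics over '…TextureBuildHealSurgery' / '…HealFamily' (census-free, standard axioms).
Nothing about any cover or texture is claimed; F-C1 not moved.

WHY.  `exists_site_heal` ('…HealSurgery') occupies every site of a finite window `W ⊆ S` of a grain lattice and returns the exact bill
`6N' − b(x') ≤ 6N − b(x) − hd(R) + ½·(Σ_V #abandoned + Σ_{K ∩ S touching R} #abandoned + cross(K ∖ S, R))`.  The constructor of the healed
`stub_TB_cover` does not want to know the geometry of the junk it cuts: it wants the three cut terms bounded by a COUNT OF DEFECTS OF THE ORIGINAL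
PACKING NEAR THE BOUNDARY OF THE WINDOW, so that a pigeonhole over candidate windows (plate slabs at `h_min/(t+6)` heights) makes the total cut
`≤ (θ/2)·N^{2/3}` — the `CoverHε` allowance ('…HealedCompositionEps').  This file proves exactly that, with crude kissing constants:

* `abandoned_le_cdeg_of_collar` — after the surgery, an abandoned adjacency of a refilled site / of a kept lattice ball touching a blocker is a VACANT
  `S`-site of `x` OUTSIDE `W` within `< 3` of `W`;
* `sum_cdeg_comm`, `sum_cdeg_le_twelve_mul_card`, `crossCount_le_twelve_mul_card_filter` — double counting and the kissing cap `cdeg ≤ 12`;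
* `card_blockers_le` — `#R ≤ 27·#W` (volume count: the balls within `1` of a site number `≤ 27`);
* **`exists_site_heal_collar`** — the site surgery with the bill `6N' − b(x') ≤ 6N − b(x) − hd(R) + 6·(#B + #J)` for ANY finite sets
  `B ⊇ {vacant S-sites outside W within < 3 of W}` and `J ⊇ {off-S balls at distance ≥ 1 from W and < 2 from W}` (the COLLAR DEFECTS), plus
  `N ≤ N' + #R`, `#R ≤ 27·#W`;
* **`exists_site_heal_family_collar`** — the same for a family of windows `W f ⊆ S_f` pairwise `> 4` apart (one healed packing for all grains):
  bill `≤ 6N − b(x) − Σ_f hd(R f) + 6·Σ_f (#B f + #J f)`, `N ≤ N' + Σ_f #R f`, `#R f ≤ 27·#W f`.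
So: a window whose 3-collar (outside the window) contains no vacant site and no off-lattice ball heals for free (this recovers '…HealSurgeryClean'
qualitatively), and in general the price is `6` per collar defect, whatever the junk inside the window is.
-/

noncomputable section

namespace Summit.Ventures.Crystal3D.Theorems

open Finset Summit.Ventures.Crystal3D
open Literature.MathematicalPhysics.StatisticalMechanics (IsHaggSeq contactDeficiency)
open Summit.Ventures.Crystal3D.Cruxes.TextureLiminf.TexShadow (E3 stacking one_le_dist_of_mem_stacking)

/-! ## Double counting and kissing caps -/

section Counting

/-- Double counting of touching pairs: `Σ_{p ∈ P} cdeg_B p = Σ_{w ∈ B} cdeg_P w`. -/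
theorem sum_cdeg_comm (P B : Finset E3) : ∑ p ∈ P, cdeg B p = ∑ w ∈ B, cdeg P w := by
  have h1 : crossCount P B = ∑ p ∈ P, cdeg B p := crossCount_eq_sum P B
  have h2 : crossCount B P = ∑ w ∈ B, cdeg P w := crossCount_eq_sum B P
  rw [← h1, ← h2, crossCount_comm]

/-- The kissing cap summed: for a `1`-separated `P`, `Σ_{w ∈ B} cdeg_P w ≤ 12·#B`. -/
theorem sum_cdeg_le_twelve_mul_card (P B : Finset E3) (hP : ∀ p ∈ P, ∀ q ∈ P, p ≠ q → 1 ≤ dist p q) :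
    ∑ w ∈ B, cdeg P w ≤ 12 * B.card := by
  calc ∑ w ∈ B, cdeg P w ≤ ∑ w ∈ B, 12 := Finset.sum_le_sum fun w _ => cdeg_le_twelve P hP w
    _ = 12 * B.card := by rw [Finset.sum_const, smul_eq_mul, mul_comm]

/-- The cross count towards a `1`-separated `R` is at most `12` times the number of points of `A` touching `R`. -/
theorem crossCount_le_twelve_mul_card_filter (A R : Finset E3) (hR : ∀ p ∈ R, ∀ q ∈ R, p ≠ q → 1 ≤ dist p q) :
    crossCount A R ≤ 12 * (A.filter fun b => ∃ a ∈ R, dist b a = 1).card := by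
  classical
  rw [crossCount_eq_sum]
  have hsplit : ∑ b ∈ A, (R.filter fun q => dist b q = 1).card =
      ∑ b ∈ A.filter (fun b => ∃ a ∈ R, dist b a = 1), (R.filter fun q => dist b q = 1).card := by
    rw [Finset.sum_filter]
    refine Finset.sum_congr rfl fun b _ => ?_
    split_ifs with h
    · rfl
    · rw [Finset.card_eq_zero, Finset.filter_eq_empty_iff]
      intro q hq hd
      exact h ⟨q, hq, hd⟩
  rw [hsplit]
  calc ∑ b ∈ A.filter (fun b => ∃ a ∈ R, dist b a = 1), (R.filter fun q => dist b q = 1).card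
      ≤ ∑ b ∈ A.filter (fun b => ∃ a ∈ R, dist b a = 1), 12 :=
        Finset.sum_le_sum fun b _ => cdeg_le_twelve R hR b
    _ = 12 * (A.filter fun b => ∃ a ∈ R, dist b a = 1).card := by rw [Finset.sum_const, smul_eq_mul, mul_comm]

/-- **Blocker count**: points of a `1`-separated `X` each within `< 1` of some point of `W` number at most `27·#W`. -/
theorem card_blockers_le (X W R : Finset E3) (hX : ∀ p ∈ X, ∀ q ∈ X, p ≠ q → 1 ≤ dist p q)
    (hR : ∀ a ∈ R, a ∈ X ∧ ∃ w ∈ W, dist a w < 1) : (R.card : ℝ) ≤ 27 * (W.card : ℝ) := by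
  classical
  have hsub : R ⊆ W.biUnion fun w => X.filter fun a => dist w a ≤ 1 := by
    intro a ha
    obtain ⟨haX, w, hw, hd⟩ := hR a ha
    rw [Finset.mem_biUnion]
    exact ⟨w, hw, Finset.mem_filter.2 ⟨haX, by rw [dist_comm]; exact hd.le⟩⟩
  calc (R.card : ℝ) ≤ ((W.biUnion fun w => X.filter fun a => dist w a ≤ 1).card : ℝ) := by
        exact_mod_cast Finset.card_le_card hsub
    _ ≤ ((∑ w ∈ W, (X.filter fun a => dist w a ≤ 1).card : ℕ) : ℝ) := by exact_mod_cast Finset.card_biUnion_le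
    _ = ∑ w ∈ W, ((X.filter fun a => dist w a ≤ 1).card : ℝ) := by push_cast; rfl
    _ ≤ ∑ w ∈ W, (27 : ℝ) := Finset.sum_le_sum fun w _ => by
        have h := card_filter_dist_le_le_cube hX w (R := 1) zero_le_one
        have h27 : (1 + 2 * (1 : ℝ)) ^ 3 = 27 := by norm_num
        rw [h27] at h
        exact h
    _ = 27 * (W.card : ℝ) := by rw [Finset.sum_const, nsmul_eq_mul, mul_comm]

end Counting

/-! ## The collar bound for one window -/

section One

variable {N : ℕ} {x : Fin N → E3} {L : E3 ≃ₗᵢ[ℝ] E3} {s : E3} {σ : ℤ → ℤ}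

/-- **Abandoned adjacencies live in the collar.**  Kept configuration `K = X ∖ R` (`R` the blockers of `W`), refilled sites `V` (the vacant sites of
`W`): for a point `p` within `< 2` of `W`, every abandoned adjacency of `p` is a vacant `S`-site of `x` outside `W` within `< 3` of `W`, hence
`#abandoned(p) ≤ cdeg_B p` for any `B` containing those sites. -/
theorem abandoned_le_cdeg_of_collar (W R V B : Finset E3)
    (hRS : ∀ a ∈ R, a ∉ stacking L s σ)
    (hVdef : ∀ v, v ∈ V ↔ v ∈ W ∧ v ∉ Set.range x)
    (hB : ∀ w, w ∈ stacking L s σ → w ∉ W → w ∉ Set.range x → (∃ w₀ ∈ W, dist w w₀ < 3) → w ∈ B)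
    {p : E3} (hp : ∃ w₀ ∈ W, dist p w₀ < 2) :
    abandoned (stacking L s σ) (Finset.univ.image x \ R) V p ≤ cdeg B p := by
  classical
  unfold abandoned cdeg
  have hsub : {w | w ∈ stacking L s σ ∧ dist p w = 1 ∧ w ∉ Finset.univ.image x \ R ∧ w ∉ V} ⊆
      (↑(B.filter fun q => dist p q = 1) : Set E3) := by
    rintro w ⟨hwS, hwd, hwK, hwV⟩
    have hwX : w ∉ Finset.univ.image x := fun h => hwK (Finset.mem_sdiff.2 ⟨h, fun hR => hRS w hR hwS⟩)
    have hwx : w ∉ Set.range x := fun h => hwX (mem_image_univ_iff_mem_range.2 h)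
    have hwW : w ∉ W := fun h => hwV ((hVdef w).2 ⟨h, hwx⟩)
    obtain ⟨w₀, hw₀, hd₀⟩ := hp
    have hnear : ∃ w₀ ∈ W, dist w w₀ < 3 := ⟨w₀, hw₀, by
      have := dist_triangle w p w₀
      rw [dist_comm w p, hwd] at this
      linarith⟩
    exact Finset.mem_coe.2 (Finset.mem_filter.2 ⟨hB w hwS hwW hwx hnear, hwd⟩)
  calc {w | w ∈ stacking L s σ ∧ dist p w = 1 ∧ w ∉ Finset.univ.image x \ R ∧ w ∉ V}.ncard
      ≤ (↑(B.filter fun q => dist p q = 1) : Set E3).ncard := Set.ncard_le_ncard hsub (Finset.finite_toSet _)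
    _ = (B.filter fun q => dist p q = 1).card := Set.ncard_coe_finset _

open scoped Classical in
/-- **THE SITE SURGERY WITH THE COLLAR BILL.**  As `exists_site_heal`, with the three cut terms bounded by `6·(#B + #J)` for any finite
`B ⊇ {w ∈ S ∖ W : w ∉ range x, dist(w, W) < 3}` (vacant collar sites) and `J ⊇ {b ∈ range x ∖ S : dist(b, W) ≥ 1, dist(b, W) < 2}` (off-lattice
collar balls), and the blocker count `#R ≤ 27·#W`. -/
theorem exists_site_heal_collar (hx : IsUnitPacking x) (hσ : IsHaggSeq σ) (W R V B J : Finset E3) (hW : ∀ w ∈ W, w ∈ stacking L s σ)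
    (hRdef : ∀ a, a ∈ R ↔ a ∈ Set.range x ∧ a ∉ stacking L s σ ∧ ∃ w ∈ W, dist a w < 1)
    (hVdef : ∀ v, v ∈ V ↔ v ∈ W ∧ v ∉ Set.range x)
    (hB : ∀ w, w ∈ stacking L s σ → w ∉ W → w ∉ Set.range x → (∃ w₀ ∈ W, dist w w₀ < 3) → w ∈ B)
    (hJ : ∀ b, b ∈ Set.range x → b ∉ stacking L s σ → (∀ w ∈ W, 1 ≤ dist b w) → (∃ w₀ ∈ W, dist b w₀ < 2) → b ∈ J) :
    ∃ (N' : ℕ) (x' : Fin N' → E3), IsUnitPacking x' ∧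
      Finset.univ.image x' = (Finset.univ.image x \ R) ∪ V ∧
      (∀ w ∈ W, w ∈ Set.range x') ∧
      (∀ y, y ∈ Set.range x' ↔
        (y ∈ Set.range x ∧ (y ∈ stacking L s σ ∨ ∀ w ∈ W, 1 ≤ dist y w)) ∨ y ∈ W) ∧
      6 * (N' : ℝ) - (numContacts x' : ℝ) ≤ 6 * (N : ℝ) - (numContacts x : ℝ) - ∑ a ∈ R, halfDefect (Finset.univ.image x) a +
        6 * ((B.card : ℝ) + (J.card : ℝ)) ∧
      N ≤ N' + R.card ∧ (R.card : ℝ) ≤ 27 * (W.card : ℝ) := by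
  classical
  obtain ⟨N', x', hx', himg, hocc, hrange, hbill, hcount⟩ := exists_site_heal hx hσ W R V hW hRdef hVdef
  have hXsep := image_sep hx
  have hmemX : ∀ {a : E3}, a ∈ Finset.univ.image x ↔ a ∈ Set.range x := fun {a} => mem_image_univ_iff_mem_range
  have hRS : ∀ a ∈ R, a ∉ stacking L s σ := fun a ha => ((hRdef a).1 ha).2.1
  have hRX : R ⊆ Finset.univ.image x := fun a ha => hmemX.2 ((hRdef a).1 ha).1
  have hRsep : ∀ p ∈ R, ∀ q ∈ R, p ≠ q → 1 ≤ dist p q := fun p hp q hq hpq => hXsep p (hRX hp) q (hRX hq) hpq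
  have hRnear : ∀ a ∈ R, ∃ w ∈ W, dist a w < 1 := fun a ha => ((hRdef a).1 ha).2.2
  refine ⟨N', x', hx', himg, hocc, hrange, ?_, hcount, ?_⟩
  · -- the refilled sites and the kept lattice balls touching a blocker, as ONE `1`-separated set of lattice points
    set K : Finset E3 := Finset.univ.image x \ R with hK
    set T : Finset E3 := K.filter (fun b => b ∈ stacking L s σ ∧ ∃ a ∈ R, dist b a = 1) with hT
    have hVS : ∀ v ∈ V, v ∈ stacking L s σ := fun v hv => hW v ((hVdef v).1 hv).1
    have hTS : ∀ b ∈ T, b ∈ stacking L s σ := fun b hb => (Finset.mem_filter.1 hb).2.1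
    have hVT : Disjoint V T := by
      rw [Finset.disjoint_left]
      intro v hv hvT
      exact ((hVdef v).1 hv).2 (hmemX.1 (Finset.mem_sdiff.1 (Finset.mem_filter.1 hvT).1).1)
    have hPsep : ∀ p ∈ V ∪ T, ∀ q ∈ V ∪ T, p ≠ q → 1 ≤ dist p q := by
      intro p hp q hq hpq
      have hpS : p ∈ stacking L s σ := by
        rcases Finset.mem_union.1 hp with h | h
        · exact hVS p h
        · exact hTS p h
      have hqS : q ∈ stacking L s σ := by
        rcases Finset.mem_union.1 hq with h | h
        · exact hVS q h
        · exact hTS q h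
      exact one_le_dist_of_mem_stacking hσ hpS hqS hpq
    -- (1)+(2): abandoned adjacencies at `V` and at `T` are collar vacancies
    have h1 : ∀ v ∈ V, abandoned (stacking L s σ) K V v ≤ cdeg B v := fun v hv =>
      abandoned_le_cdeg_of_collar W R V B hRS hVdef hB ⟨v, ((hVdef v).1 hv).1, by rw [dist_self]; norm_num⟩
    have h2 : ∀ b ∈ T, abandoned (stacking L s σ) K V b ≤ cdeg B b := by
      intro b hb
      obtain ⟨-, -, a, ha, hba⟩ := Finset.mem_filter.1 hb
      obtain ⟨w₀, hw₀, haw⟩ := hRnear a ha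
      refine abandoned_le_cdeg_of_collar W R V B hRS hVdef hB ⟨w₀, hw₀, ?_⟩
      have := dist_triangle b a w₀
      linarith
    have h12 : ∑ v ∈ V, abandoned (stacking L s σ) K V v + ∑ b ∈ T, abandoned (stacking L s σ) K V b ≤ 12 * B.card := by
      calc ∑ v ∈ V, abandoned (stacking L s σ) K V v + ∑ b ∈ T, abandoned (stacking L s σ) K V b
          ≤ ∑ v ∈ V, cdeg B v + ∑ b ∈ T, cdeg B b := Nat.add_le_add (Finset.sum_le_sum h1) (Finset.sum_le_sum h2)
        _ = ∑ p ∈ V ∪ T, cdeg B p := (Finset.sum_union hVT).symm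
        _ = ∑ w ∈ B, cdeg (V ∪ T) w := sum_cdeg_comm _ _
        _ ≤ 12 * B.card := sum_cdeg_le_twelve_mul_card _ _ hPsep
    -- (3): severed junk–junk contacts are at off-lattice collar balls
    have hJsub : ((K.filter fun b => b ∉ stacking L s σ).filter fun b => ∃ a ∈ R, dist b a = 1) ⊆ J := by
      intro b hb
      obtain ⟨hb1, a, ha, hba⟩ := Finset.mem_filter.1 hb
      obtain ⟨hbK, hbS⟩ := Finset.mem_filter.1 hb1
      obtain ⟨hbX, hbR⟩ := Finset.mem_sdiff.1 hbK
      have hbx : b ∈ Set.range x := hmemX.1 hbX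
      have hfar : ∀ w ∈ W, 1 ≤ dist b w := by
        intro w hw
        by_contra hlt
        push Not at hlt
        exact hbR ((hRdef b).2 ⟨hbx, hbS, w, hw, hlt⟩)
      obtain ⟨w₀, hw₀, haw⟩ := hRnear a ha
      refine hJ b hbx hbS hfar ⟨w₀, hw₀, ?_⟩
      have := dist_triangle b a w₀
      linarith
    have h3 : crossCount (K.filter fun b => b ∉ stacking L s σ) R ≤ 12 * J.card :=
      calc crossCount (K.filter fun b => b ∉ stacking L s σ) R
          ≤ 12 * ((K.filter fun b => b ∉ stacking L s σ).filter fun b => ∃ a ∈ R, dist b a = 1).card :=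
            crossCount_le_twelve_mul_card_filter _ R hRsep
        _ ≤ 12 * J.card := Nat.mul_le_mul_left _ (Finset.card_le_card hJsub)
    have h12' : (∑ v ∈ V, (abandoned (stacking L s σ) K V v : ℝ)) + ∑ b ∈ T, (abandoned (stacking L s σ) K V b : ℝ) ≤
        12 * (B.card : ℝ) := by exact_mod_cast h12
    have h3' : (crossCount (K.filter fun b => b ∉ stacking L s σ) R : ℝ) ≤ 12 * (J.card : ℝ) := by exact_mod_cast h3
    linarith
  · exact card_blockers_le (Finset.univ.image x) W R hXsep fun a ha => ⟨hRX ha, hRnear a ha⟩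

end One

/-! ## The collar bound for a family of windows -/

section Family

variable {N : ℕ} {x : Fin N → E3} {ι : Type*} [Fintype ι]
  {L : ι → (E3 ≃ₗᵢ[ℝ] E3)} {s : ι → E3} {σ : ι → ℤ → ℤ}

open scoped Classical in
/-- **THE SITE SURGERY, FAMILY FORM, WITH THE COLLAR BILL.**  As `exists_site_heal_family` (windows `W f ⊆ S_f` pairwise `> 4` apart), with grain
`f`'s cut terms bounded by `6·(#B f + #J f)` for any finite `B f ⊇ {w ∈ S_f ∖ W f : w ∉ range x, dist(w, W f) < 3}` and
`J f ⊇ {b ∈ range x ∖ S_f : dist(b, W f) ≥ 1, dist(b, W f) < 2}`, and `#R f ≤ 27·#W f`. -/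
theorem exists_site_heal_family_collar (hx : IsUnitPacking x) (hσ : ∀ f, IsHaggSeq (σ f)) (W R V B J : ι → Finset E3)
    (hW : ∀ f, ∀ w ∈ W f, w ∈ stacking (L f) (s f) (σ f))
    (hRdef : ∀ f a, a ∈ R f ↔ a ∈ Set.range x ∧ a ∉ stacking (L f) (s f) (σ f) ∧ ∃ w ∈ W f, dist a w < 1)
    (hVdef : ∀ f v, v ∈ V f ↔ v ∈ W f ∧ v ∉ Set.range x)
    (hfar : ∀ f g, f ≠ g → ∀ w ∈ W f, ∀ w' ∈ W g, 4 < dist w w')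
    (hB : ∀ f w, w ∈ stacking (L f) (s f) (σ f) → w ∉ W f → w ∉ Set.range x → (∃ w₀ ∈ W f, dist w w₀ < 3) → w ∈ B f)
    (hJ : ∀ f b, b ∈ Set.range x → b ∉ stacking (L f) (s f) (σ f) → (∀ w ∈ W f, 1 ≤ dist b w) →
      (∃ w₀ ∈ W f, dist b w₀ < 2) → b ∈ J f) :
    ∃ (N' : ℕ) (x' : Fin N' → E3), IsUnitPacking x' ∧
      Finset.univ.image x' = (Finset.univ.image x \ Finset.univ.biUnion R) ∪ Finset.univ.biUnion V ∧
      (∀ f, ∀ w ∈ W f, w ∈ Set.range x') ∧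
      (∀ y, y ∈ Set.range x' ↔
        (y ∈ Set.range x ∧ ∀ f, y ∈ stacking (L f) (s f) (σ f) ∨ ∀ w ∈ W f, 1 ≤ dist y w) ∨ ∃ f, y ∈ W f) ∧
      6 * (N' : ℝ) - (numContacts x' : ℝ) ≤ 6 * (N : ℝ) - (numContacts x : ℝ) -
        ∑ f, ∑ a ∈ R f, halfDefect (Finset.univ.image x) a + 6 * ∑ f, ((B f).card + (J f).card : ℝ) ∧
      N ≤ N' + ∑ f, (R f).card ∧ (∀ f, ((R f).card : ℝ) ≤ 27 * ((W f).card : ℝ)) := by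
  classical
  obtain ⟨N', x', hx', himg, hocc, hrange, hbill, hcount⟩ := exists_site_heal_family hx hσ W R V hW hRdef hVdef hfar
  have hXsep := image_sep hx
  have hmemX : ∀ {a : E3}, a ∈ Finset.univ.image x ↔ a ∈ Set.range x := fun {a} => mem_image_univ_iff_mem_range
  have hRS : ∀ f, ∀ a ∈ R f, a ∉ stacking (L f) (s f) (σ f) := fun f a ha => ((hRdef f a).1 ha).2.1
  have hRX : ∀ f, R f ⊆ Finset.univ.image x := fun f a ha => hmemX.2 ((hRdef f a).1 ha).1
  have hRsep : ∀ f, ∀ p ∈ R f, ∀ q ∈ R f, p ≠ q → 1 ≤ dist p q := fun f p hp q hq hpq => hXsep p (hRX f hp) q (hRX f hq) hpq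
  have hRnear : ∀ f, ∀ a ∈ R f, ∃ w ∈ W f, dist a w < 1 := fun f a ha => ((hRdef f a).1 ha).2.2
  refine ⟨N', x', hx', himg, hocc, hrange, ?_, hcount, fun f => ?_⟩
  · set K : Finset E3 := Finset.univ.image x \ Finset.univ.biUnion R with hK
    set Vall : Finset E3 := Finset.univ.biUnion V with hVall
    -- per grain, the bound `cut_f ≤ 12·#B f + 12·#J f`
    have hper : ∀ f,
        (∑ v ∈ V f, (abandoned (stacking (L f) (s f) (σ f)) K Vall v : ℝ)) +
          ∑ b ∈ K.filter (fun b => b ∈ stacking (L f) (s f) (σ f) ∧ ∃ a ∈ R f, dist b a = 1),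
            (abandoned (stacking (L f) (s f) (σ f)) K Vall b : ℝ) +
          (crossCount (K.filter fun b => b ∉ stacking (L f) (s f) (σ f)) (R f) : ℝ) ≤
        12 * ((B f).card : ℝ) + 12 * ((J f).card : ℝ) := by
      intro f
      set S : Set E3 := stacking (L f) (s f) (σ f) with hS
      set T : Finset E3 := K.filter (fun b => b ∈ S ∧ ∃ a ∈ R f, dist b a = 1) with hT
      have hVS : ∀ v ∈ V f, v ∈ S := fun v hv => hW f v ((hVdef f v).1 hv).1
      have hTS : ∀ b ∈ T, b ∈ S := fun b hb => (Finset.mem_filter.1 hb).2.1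
      have hVT : Disjoint (V f) T := by
        rw [Finset.disjoint_left]
        intro v hv hvT
        exact ((hVdef f v).1 hv).2 (hmemX.1 (Finset.mem_sdiff.1 (Finset.mem_filter.1 hvT).1).1)
      have hPsep : ∀ p ∈ V f ∪ T, ∀ q ∈ V f ∪ T, p ≠ q → 1 ≤ dist p q := by
        intro p hp q hq hpq
        have hpS : p ∈ S := by
          rcases Finset.mem_union.1 hp with h | h
          · exact hVS p h
          · exact hTS p h
        have hqS : q ∈ S := by
          rcases Finset.mem_union.1 hq with h | h
          · exact hVS q h
          · exact hTS q h
        exact one_le_dist_of_mem_stacking (hσ f) hpS hqS hpq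
      -- the collar inclusion for grain `f`: an abandoned adjacency near `W f` is a vacant `S_f`-site of `x` outside `W f`
      have hab : ∀ p : E3, (∃ w₀ ∈ W f, dist p w₀ < 2) → abandoned S K Vall p ≤ cdeg (B f) p := by
        intro p hp
        unfold abandoned cdeg
        have hsub : {w | w ∈ S ∧ dist p w = 1 ∧ w ∉ K ∧ w ∉ Vall} ⊆ (↑((B f).filter fun q => dist p q = 1) : Set E3) := by
          rintro w ⟨hwS, hwd, hwK, hwV⟩
          obtain ⟨w₀, hw₀, hd₀⟩ := hp
          have hnear : dist w w₀ < 3 := by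
            have := dist_triangle w p w₀
            rw [dist_comm w p, hwd] at this
            linarith
          -- `w` is no blocker of any grain: of `f` because it is on `S_f`, of `g ≠ f` because it is within `3` of `W f`
          have hwR : w ∉ Finset.univ.biUnion R := by
            intro h
            obtain ⟨g, -, hwg⟩ := Finset.mem_biUnion.1 h
            by_cases hgf : g = f
            · subst hgf
              exact hRS g w hwg hwS
            · obtain ⟨w', hw', hd'⟩ := hRnear g w hwg
              have h4 := hfar f g (Ne.symm hgf) w₀ hw₀ w' hw'
              have := dist_triangle w₀ w w'
              rw [dist_comm w₀ w] at this
              linarith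
          have hwX : w ∉ Finset.univ.image x := fun h => hwK (Finset.mem_sdiff.2 ⟨h, hwR⟩)
          have hwx : w ∉ Set.range x := fun h => hwX (hmemX.2 h)
          have hwW : w ∉ W f := fun h => hwV (Finset.mem_biUnion.2 ⟨f, Finset.mem_univ _, (hVdef f w).2 ⟨h, hwx⟩⟩)
          exact Finset.mem_coe.2 (Finset.mem_filter.2 ⟨hB f w hwS hwW hwx ⟨w₀, hw₀, hnear⟩, hwd⟩)
        calc {w | w ∈ S ∧ dist p w = 1 ∧ w ∉ K ∧ w ∉ Vall}.ncard
            ≤ (↑((B f).filter fun q => dist p q = 1) : Set E3).ncard := Set.ncard_le_ncard hsub (Finset.finite_toSet _)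
          _ = ((B f).filter fun q => dist p q = 1).card := Set.ncard_coe_finset _
      have h1 : ∀ v ∈ V f, abandoned S K Vall v ≤ cdeg (B f) v := fun v hv =>
        hab v ⟨v, ((hVdef f v).1 hv).1, by rw [dist_self]; norm_num⟩
      have h2 : ∀ b ∈ T, abandoned S K Vall b ≤ cdeg (B f) b := by
        intro b hb
        obtain ⟨-, -, a, ha, hba⟩ := Finset.mem_filter.1 hb
        obtain ⟨w₀, hw₀, haw⟩ := hRnear f a ha
        refine hab b ⟨w₀, hw₀, ?_⟩
        have := dist_triangle b a w₀
        linarith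
      have h12 : ∑ v ∈ V f, abandoned S K Vall v + ∑ b ∈ T, abandoned S K Vall b ≤ 12 * (B f).card := by
        calc ∑ v ∈ V f, abandoned S K Vall v + ∑ b ∈ T, abandoned S K Vall b
            ≤ ∑ v ∈ V f, cdeg (B f) v + ∑ b ∈ T, cdeg (B f) b := Nat.add_le_add (Finset.sum_le_sum h1) (Finset.sum_le_sum h2)
          _ = ∑ p ∈ V f ∪ T, cdeg (B f) p := (Finset.sum_union hVT).symm
          _ = ∑ w ∈ B f, cdeg (V f ∪ T) w := sum_cdeg_comm _ _
          _ ≤ 12 * (B f).card := sum_cdeg_le_twelve_mul_card _ _ hPsep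
      have hJsub : ((K.filter fun b => b ∉ S).filter fun b => ∃ a ∈ R f, dist b a = 1) ⊆ J f := by
        intro b hb
        obtain ⟨hb1, a, ha, hba⟩ := Finset.mem_filter.1 hb
        obtain ⟨hbK, hbS⟩ := Finset.mem_filter.1 hb1
        obtain ⟨hbX, hbR⟩ := Finset.mem_sdiff.1 hbK
        have hbx : b ∈ Set.range x := hmemX.1 hbX
        have hfarW : ∀ w ∈ W f, 1 ≤ dist b w := by
          intro w hw
          by_contra hlt
          push Not at hlt
          exact hbR (Finset.mem_biUnion.2 ⟨f, Finset.mem_univ _, (hRdef f b).2 ⟨hbx, hbS, w, hw, hlt⟩⟩)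
        obtain ⟨w₀, hw₀, haw⟩ := hRnear f a ha
        refine hJ f b hbx hbS hfarW ⟨w₀, hw₀, ?_⟩
        have := dist_triangle b a w₀
        linarith
      have h3 : crossCount (K.filter fun b => b ∉ S) (R f) ≤ 12 * (J f).card :=
        calc crossCount (K.filter fun b => b ∉ S) (R f)
            ≤ 12 * ((K.filter fun b => b ∉ S).filter fun b => ∃ a ∈ R f, dist b a = 1).card :=
              crossCount_le_twelve_mul_card_filter _ (R f) (hRsep f)
          _ ≤ 12 * (J f).card := Nat.mul_le_mul_left _ (Finset.card_le_card hJsub)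
      have h12' : (∑ v ∈ V f, (abandoned S K Vall v : ℝ)) + ∑ b ∈ T, (abandoned S K Vall b : ℝ) ≤ 12 * ((B f).card : ℝ) := by
        exact_mod_cast h12
      have h3' : (crossCount (K.filter fun b => b ∉ S) (R f) : ℝ) ≤ 12 * ((J f).card : ℝ) := by exact_mod_cast h3
      linarith
    have hsum := Finset.sum_le_sum fun f (_ : f ∈ Finset.univ) => hper f
    have hsplit : ∑ f, (12 * ((B f).card : ℝ) + 12 * ((J f).card : ℝ)) = 12 * ∑ f, ((B f).card + (J f).card : ℝ) := by
      rw [Finset.mul_sum]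
      exact Finset.sum_congr rfl fun f _ => by ring
    rw [hsplit] at hsum
    linarith
  · exact card_blockers_le (Finset.univ.image x) (W f) (R f) hXsep fun a ha => ⟨hRX f ha, hRnear f a ha⟩

end Family

end Summit.Ventures.Crystal3D.Theorems

end
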